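import Summits.Parity.GeneralizedHardyLittlewood.Theorems.GoldbachHeathBrownDispersionHeathBrownMorozUniformClassDisplay104Sums
import HarnessLib

/-!
# Crux `HeathBrownMorozUniform` (stmt-Parity-19915), line `parent-differencing`, stub `stub_classDisplay104`, III:
# the class display (10.4) with explicit constants

Helper file (`--supports stmt-Parity-19915`): the class twin of the `Assembly` section of
`Literature/…/HeathBrownCubicLeadingA.lean` (`assembly_abs_le`, `display_10_4_core`) for the residue-class subfamily
`classPairs X η d a b` (Heath-Brown–Moroz 2004, Lemma 4.1), proving at one point `(X, η, 𝐦, c_R)` of the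
standing set-up

  `|U_e(𝒜_cl; 𝐦, c) − (w(d)/d²)·σ₀η²X²Σ₃(𝐦, c)| ≤ C(d, σ₀, …)·M⁻¹η^{5/2}X²(log X)²`

from two HYPOTHESES: the class Type-I square-free sum (shape of the skeleton's `ClassTypeISqfreeSum`, PROVED
there from the landed `class_typeI_A`) and the coprime-restricted singular sum `Σ₁^{(d)}` (shape of the
skeleton's `ClassSigmaOneCoprime`).  The error of (10.1)–(10.2) is bounded by the PARENT's (`classCountA ≤ countA`,
parent Type I `exists_typeI_squarefree_sum_le` as a hypothesis `hTIp`); `Σ'`, `ρ₂(R) = 1 + O(τ⁻¹X^{−τ})`, `Σ₃`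
and all numerics are the parent's lemmas verbatim; `(d, N R) = 1` on the support of `c_R` because `X^τ > d`;
the main-term constant is `X_cl·(π²/6)·coprimeClassWeight d = (w(d)/d²)η²X²`
(`coprimeClassWeight_mul_zetaTwoCorrection`).

**Goldbach is not proved here** (FRONTIER formalisation rung `GoldbachHeathBrownDispersion` only).

References: [cite: HeathBrownActa2001, §10 (10.1)–(10.4)]; [cite: HeathBrownMoroz2004, Lemma 4.1 and (3.1)].
Tree: `HeathBrownCubicLeadingA` (`abs_wDeriv_cofactor_sub_le(_one)`, `E1_pairs_le_two/one`, `abs_sigmaPrime(_sub)_le`,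
`sum_alpha_div_eq_sigma3`, `typeI_total_le`, `numeric_*`, `prodWeight_pos`, `hbL_facts`),
`…ClassDisplay104Sums` (`classU1_eq_pairs`, `abs_classUe_sub_U1_le`, `abs_classU1_sub_U2_le`, `class_typeI_total_le`,
`classSizeA_le`), `…ClassDisplay104Pairs` (`sum_pairs_classCountA_le_countA`), `HeathBrownMorozResidueClassesSieve`
(`coprimeClassWeight_mul_zetaTwoCorrection`).
-/

noncomputable section

open Polynomial NumberField Finset Filter Topology

namespace Summit.Parity.GeneralizedHardyLittlewood.Theorems.GoldbachHeathBrownDispersionHeathBrownMorozUniform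

open Literature.NumberTheory.Sieve.CubicSieve Literature.NumberTheory.Sieve.CubicPrimes
open Literature.NumberTheory.LFunctions.CubeRootTwoField


/-! ### The assembly of the class display (10.4) -/

section Assembly

variable {X η τ : ℝ} {d a b : ℕ}

/-- **"A comparison … establishes (10.4)"**, class version: the decomposition
`U_e(𝒜_cl) − Wσ₀η²X²Σ₃ = (U_e − U₁) + (U₁ − X_clΣ'Σ₁^{(d)}) + X_clΣ'(Σ₁^{(d)} − (π²/6)σ₀c_w) + Wσ₀η²X²(Σ' − Σ₃)`
(`X_cl·(π²/6)c_w = W·η²X²`, `W = w(d)/d²`, `c_w = coprimeClassWeight d`) and the triangle inequality.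
[cite: HeathBrownMoroz2004, Lemma 4.1] [cite: HeathBrownActa2001, §10 (10.4)] -/
theorem class_assembly_abs_le {Ue U₁ P Sp S1 S3'' S3 sA W cw σ₀ η X E1 E2 E3 E4 B : ℝ}
    (hP : P = U₁) (hS3 : S3'' = S3) (hsA : sA * (Real.pi ^ 2 / 6 * cw) = W * (η ^ 2 * X ^ 2)) (hsA0 : 0 ≤ sA)
    (hE1 : |Ue - U₁| ≤ E1) (hE2 : |P - sA * Sp * S1| ≤ E2)
    (hE3 : sA * |Sp| * |S1 - Real.pi ^ 2 / 6 * σ₀ * cw| ≤ E3)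
    (hE4 : |W * σ₀| * (η ^ 2 * X ^ 2) * |Sp - S3''| ≤ E4) (hsum : E1 + E2 + E3 + E4 ≤ B) :
    |Ue - W * (σ₀ * η ^ 2 * X ^ 2 * S3)| ≤ B := by
  have hdecomp : Ue - W * (σ₀ * η ^ 2 * X ^ 2 * S3) =
      (Ue - U₁) + (P - sA * Sp * S1) + sA * Sp * (S1 - Real.pi ^ 2 / 6 * σ₀ * cw) +
        W * σ₀ * (η ^ 2 * X ^ 2) * (Sp - S3'') := by
    linear_combination (-1 : ℝ) * hP + σ₀ * Sp * hsA + W * σ₀ * η ^ 2 * X ^ 2 * hS3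
  rw [hdecomp]
  have h3 : |sA * Sp * (S1 - Real.pi ^ 2 / 6 * σ₀ * cw)| = sA * |Sp| * |S1 - Real.pi ^ 2 / 6 * σ₀ * cw| := by
    rw [abs_mul, abs_mul, abs_of_nonneg hsA0]
  have h4 : |W * σ₀ * (η ^ 2 * X ^ 2) * (Sp - S3'')| = |W * σ₀| * (η ^ 2 * X ^ 2) * |Sp - S3''| := by
    rw [abs_mul, abs_mul, abs_of_nonneg (by positivity : (0:ℝ) ≤ η ^ 2 * X ^ 2)]
  calc |(Ue - U₁) + (P - sA * Sp * S1) + sA * Sp * (S1 - Real.pi ^ 2 / 6 * σ₀ * cw) +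
        W * σ₀ * (η ^ 2 * X ^ 2) * (Sp - S3'')|
      ≤ |(Ue - U₁) + (P - sA * Sp * S1) + sA * Sp * (S1 - Real.pi ^ 2 / 6 * σ₀ * cw)| +
        |W * σ₀ * (η ^ 2 * X ^ 2) * (Sp - S3'')| := abs_add_le _ _
    _ ≤ |(Ue - U₁) + (P - sA * Sp * S1)| + |sA * Sp * (S1 - Real.pi ^ 2 / 6 * σ₀ * cw)| +
        |W * σ₀ * (η ^ 2 * X ^ 2) * (Sp - S3'')| := by gcongr; exact abs_add_le _ _
    _ ≤ |Ue - U₁| + |P - sA * Sp * S1| + |sA * Sp * (S1 - Real.pi ^ 2 / 6 * σ₀ * cw)| +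
        |W * σ₀ * (η ^ 2 * X ^ 2) * (Sp - S3'')| := by gcongr; exact abs_add_le _ _
    _ ≤ E1 + E2 + E3 + E4 := by rw [h3, h4]; gcongr
    _ ≤ B := hsum

/-- The class main-term constant: `X_cl·((π²/6)·coprimeClassWeight d) = (w(d)/d²)·η²X²`
(`coprimeClassWeight d · ζ(2)/ζ_d(2) = w(d)`). [cite: HeathBrownMoroz2004, §3 (3.1)] -/
theorem classSizeA_mul_coprimeClassWeight (X η : ℝ) (d : ℕ) :
    classSizeA X η d * (Real.pi ^ 2 / 6 * coprimeClassWeight d) =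
      classWeight d / (d : ℝ) ^ 2 * (η ^ 2 * X ^ 2) := by
  rw [← coprimeClassWeight_mul_zetaTwoCorrection, classSizeA]
  have hπ : Real.pi ^ 2 ≠ 0 := pow_ne_zero 2 Real.pi_ne_zero
  field_simp

open scoped Classical in
/-- Terms with `N(J) = x` contribute nothing to `Σ₁^{(d)}(x)` (`log(x/N J) = 0`): the sum over `N(J) < x`
equals the sum over `N(J) ≤ x`. [cite: HeathBrownActa2001, §10 p. 63] -/
theorem classSigmaOne_filter_lt_eq {x : ℝ} (hx : 1 ≤ x) :
    ∑ J ∈ ((idealsLE ⌊x⌋₊).filter (fun J => (Ideal.absNorm J : ℝ) < x)).filter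
        (fun J => Squarefree (Ideal.absNorm J) ∧ Nat.Coprime d (Ideal.absNorm J)),
        (idealMoebius J * Real.log (x / Ideal.absNorm J)) * (rho₂ J / Ideal.absNorm J) =
      ∑ J ∈ (idealsLE ⌊x⌋₊).filter
        (fun J => Squarefree (Ideal.absNorm J) ∧ Nat.Coprime d (Ideal.absNorm J)),
        idealMoebius J * Real.log (x / Ideal.absNorm J) * (rho₂ J / Ideal.absNorm J) := by
  have hsub : ((idealsLE ⌊x⌋₊).filter (fun J => (Ideal.absNorm J : ℝ) < x)).filter
        (fun J => Squarefree (Ideal.absNorm J) ∧ Nat.Coprime d (Ideal.absNorm J)) ⊆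
      (idealsLE ⌊x⌋₊).filter (fun J => Squarefree (Ideal.absNorm J) ∧ Nat.Coprime d (Ideal.absNorm J)) :=
    fun J hJ => by
      rw [mem_filter, mem_filter] at hJ
      rw [mem_filter]
      exact ⟨hJ.1.1, hJ.2⟩
  rw [Finset.sum_subset hsub]
  intro J hJ hJ'
  rw [mem_filter] at hJ
  have hge : x ≤ (Ideal.absNorm J : ℝ) := by
    by_contra hlt
    push Not at hlt
    exact hJ' (mem_filter.mpr ⟨mem_filter.mpr ⟨hJ.1, hlt⟩, hJ.2⟩)
  have hJx : Ideal.absNorm J ≤ ⌊x⌋₊ := mem_idealsLE.1 hJ.1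
  have hle : (Ideal.absNorm J : ℝ) ≤ x := le_trans (by exact_mod_cast hJx) (Nat.floor_le (by linarith))
  have heq : (Ideal.absNorm J : ℝ) = x := le_antisymm hle hge
  rw [heq, div_self (by linarith), Real.log_one, mul_zero, zero_mul]

set_option maxHeartbeats 1000000 in
open scoped Classical in
/-- **The class display (10.4) with explicit constants**, at one point `(X, η, 𝐦, c_R)` of the standing set-up of
Lemma 3.9 (`X` large in terms of the constants and of `d`: `X ≥ 4(d+2)²`, `X^τ > d`; `η` in the range (2.1);
`𝐦` admissible; `c_R` as in (3.3)): from the class Type-I square-free sum (`hTI`, constant `C₂`, exponent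
`k₂`) and the coprime-restricted singular sum `Σ₁^{(d)}` (`hSig1`, constants `c₁, C₁`),
`|U_e(𝒜_cl) − (w(d)/d²)σ₀η²X²Σ₃| ≤ C·M⁻¹η^{5/2}X²(log X)²`,
`C = 15C₃² + 3C₃(γ₀ + C_w) + 5C₁C₃ + 20C₃|(w(d)/d²)σ₀| + 2` — HBM's proof of Lemma 4.1 ((4.1)–(4.3)) in the
tree's organisation of Heath-Brown's pp. 60–64. [cite: HeathBrownMoroz2004, Lemma 4.1]
[cite: HeathBrownActa2001, §10 (10.4)] -/
theorem classDisplay104_core {σ₀ c₁ C₁ C₂ C₃ Cw : ℝ} {k₂ : ℕ} (hC₁ : 0 ≤ C₁) (hC₂ : 0 ≤ C₂) (hC₃ : 0 ≤ C₃)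
    (hCw : 0 ≤ Cw) (hd : 0 < d)
    (hSig1 : ∀ x : ℝ, 1 ≤ x →
      |(∑ J ∈ (idealsLE ⌊x⌋₊).filter
          (fun J => Squarefree (Ideal.absNorm J) ∧ Nat.Coprime d (Ideal.absNorm J)),
          idealMoebius J * Real.log (x / Ideal.absNorm J) * (rho₂ J / Ideal.absNorm J)) -
        Real.pi ^ 2 / 6 * σ₀ * coprimeClassWeight d| ≤ C₁ * Real.exp (-c₁ * Real.sqrt (Real.log x)))
    (hTI : ∀ X η B : ℝ, 4 * ((d : ℝ) + 2) ^ 2 ≤ X →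
      Real.exp (-Real.log X ^ (1 / 3 : ℝ)) ≤ η → η ≤ 1 → 1 ≤ B → B ≤ X ^ 3 →
        ∑ D ∈ (idealsLE ⌊B⌋₊).filter (fun D => Squarefree (Ideal.absNorm D)),
            |(classCountA X η d a b D : ℝ) -
              (if Nat.Coprime d (Ideal.absNorm D) then
                6 * η ^ 2 * X ^ 2 / Real.pi ^ 2 * zetaTwoCorrection d / (d : ℝ) ^ 2 * rho₂ D /
                  Ideal.absNorm D else 0)| ≤
          C₂ * (X * (1 + Real.log X) + (B + X * Real.sqrt B + X ^ (3 / 2 : ℝ)) * Real.log X ^ (k₂ + 1)))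
    (hTIp : ∀ X η B : ℝ, 3 ≤ X → Real.exp (-Real.log X ^ (1 / 3 : ℝ)) ≤ η → η ≤ 1 → 1 ≤ B → B ≤ X ^ 3 →
      ∑ D ∈ (idealsLE ⌊B⌋₊).filter (fun D => Squarefree (Ideal.absNorm D)),
          |(countA X η D : ℝ) - sizeA X η * rho₂ D / Ideal.absNorm D| ≤
        C₂ * (X * (1 + Real.log X) + (B + X * Real.sqrt B + X ^ (3 / 2 : ℝ)) * Real.log X ^ (k₂ + 1)))
    (hharm : ∀ N : ℕ, 1 ≤ N → ∑ R ∈ (idealsLE N).filter (fun R => R ≠ ⊥), ((Ideal.absNorm R : ℕ) : ℝ)⁻¹ ≤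
      C₃ * (1 + Real.log N))
    (hwin : ∀ A η : ℝ, 1 ≤ A → 0 ≤ η → η ≤ 1 →
      ∑ R ∈ (idealsLE ⌊A * (1 + η)⌋₊).filter (fun R => A < (Ideal.absNorm R : ℝ)),
        ((Ideal.absNorm R : ℕ) : ℝ)⁻¹ ≤ gamma₀ * η + Cw * A ^ (-(1 / 3 : ℝ)))
    (hXd : 4 * ((d : ℝ) + 2) ^ 2 ≤ X) (hℓ8 : 8 ≤ Real.log X) (hτ : 0 < τ) (hτ8 : τ ≤ 1 / 8)
    (h10 : 1 ≤ τ ^ 10 * Real.log X) (hdτ : (d : ℝ) < X ^ τ)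
    (hhalf : X ^ (-(1 / 2 : ℝ)) ≤ Real.exp (-Real.log X ^ (1 / 3 : ℝ)))
    (hexp : Real.log X * Real.exp (-c₁ * Real.sqrt (τ * Real.log X / 2)) ≤ Real.exp (-2 * Real.log X ^ (1 / 3 : ℝ)))
    (hT1 : 96 * (C₂ + 1) * X ^ (-τ / 4) * Real.log X ^ k₂ ≤ Real.exp (-3 * Real.log X ^ (1 / 3 : ℝ)))
    (hT2 : 32 * (C₂ + 1) * X ^ (-τ / 4) * Real.log X ^ (k₂ + 1) ≤ Real.exp (-3 * Real.log X ^ (1 / 3 : ℝ)))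
    (hηlo : Real.exp (-Real.log X ^ (1 / 3 : ℝ)) ≤ η) (hη1 : η ≤ 1)
    {k : ℕ} {m : Fin k → ℕ} (hm : CoreAdmissible τ m) {cR : Ideal (𝓞 K) → ℝ} (hc : CSupport X τ cR) :
    |bilin (classPairs X η d a b) pairIdeal cR (eWeight X τ m) -
        classWeight d / (d : ℝ) ^ 2 * (σ₀ * η ^ 2 * X ^ 2 * sigma3 X τ m cR)| ≤
      (15 * C₃ ^ 2 + 3 * C₃ * (gamma₀ + Cw) + 5 * C₁ * C₃ +
          20 * C₃ * |classWeight d / (d : ℝ) ^ 2 * σ₀| + 2) *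
        ((∏ i, (m i : ℝ))⁻¹ * η ^ (5 / 2 : ℝ) * X ^ 2 * Real.log X ^ 2) := by
  -- scalars
  have hd1 : (1 : ℝ) ≤ d := by exact_mod_cast hd
  have hX : 24 ≤ X := by nlinarith
  have hX1 : 1 < X := by linarith
  have hX0 : 0 < X := by linarith
  have hτ1 : τ ≤ 1 := by linarith
  obtain ⟨hη0, hτpow, hτℓ2, hexp3, hexp2, hη3, hη4, hη5⟩ := numeric_facts hτ hτ8 h10 hηlo hη1
  obtain ⟨n, rfl⟩ : ∃ n, k = n + 1 := Nat.exists_eq_succ_of_ne_zero (length_pos_of_coreAdmissible hτ hm).ne'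
  obtain ⟨hΛ0, hM1, hDeq, hD0⟩ := prodWeight_pos hX1 hτ hτ1 hm
  obtain ⟨hL1, hLz, hlogL⟩ := hbL_facts hX1.le hτ.le
  have hℓ1 : 1 ≤ Real.log X := by linarith
  have hΛeq : hbXi τ * Real.log X = τ ^ 5 * Real.log X := by rw [hbXi]
  have hγ : 0 ≤ gamma₀ := gamma₀_pos.le
  have hηle : X ^ (-(1 / 2 : ℝ)) ≤ η := hhalf.trans hηlo
  set W : ℝ := classWeight d / (d : ℝ) ^ 2 with hWdef
  have hW0 : 0 ≤ W := div_nonneg (classWeight_pos d).le (pow_nonneg (Nat.cast_nonneg d) 2)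
  -- `lN`, `lL`
  have hlN0 : 0 ≤ Real.log (⌊24 * X ^ 3⌋₊ : ℕ) := Real.log_natCast_nonneg _
  have hlN4 : 1 + Real.log (⌊24 * X ^ 3⌋₊ : ℕ) ≤ 5 * Real.log X := by
    have h24 : (1 : ℝ) ≤ 24 * X ^ 3 := by nlinarith [one_le_pow₀ hX1.le (n := 3)]
    have hfl1 : (1 : ℝ) ≤ (⌊24 * X ^ 3⌋₊ : ℕ) := by exact_mod_cast Nat.le_floor (by exact_mod_cast h24)
    have h1 : ((⌊24 * X ^ 3⌋₊ : ℕ) : ℝ) ≤ X ^ 4 := by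
      refine (Nat.floor_le (by positivity)).trans ?_
      have hX3 : 0 < X ^ 3 := pow_pos hX0 3
      nlinarith
    have h2 : Real.log (⌊24 * X ^ 3⌋₊ : ℕ) ≤ Real.log (X ^ 4) := Real.log_le_log (by linarith) h1
    rw [Real.log_pow] at h2
    push_cast at h2
    linarith
  have hlL0 : 0 ≤ Real.log (⌊hbL X τ⌋₊ : ℕ) := Real.log_natCast_nonneg _
  have hlL : 1 + Real.log (⌊hbL X τ⌋₊ : ℕ) ≤ τ * Real.log X := by
    have hfl1 : (1 : ℝ) ≤ (⌊hbL X τ⌋₊ : ℕ) := by exact_mod_cast Nat.le_floor (by exact_mod_cast hL1)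
    have h1 : ((⌊hbL X τ⌋₊ : ℕ) : ℝ) ≤ hbL X τ := Nat.floor_le (by linarith)
    have h2 : Real.log (⌊hbL X τ⌋₊ : ℕ) ≤ Real.log (hbL X τ) := Real.log_le_log (by linarith) h1
    rw [hlogL] at h2
    linarith
  -- `X_cl` and `X_𝒜`
  have hsA0 : 0 ≤ classSizeA X η d := classSizeA_nonneg X η d
  have hsAle : classSizeA X η d ≤ η ^ 2 * X ^ 2 := classSizeA_le hd
  have hsAeq := classSizeA_mul_coprimeClassWeight X η d
  have hsAp0 : 0 ≤ sizeA X η := sizeA_nonneg X η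
  have hsAple : sizeA X η ≤ η ^ 2 * X ^ 2 := by
    rw [sizeA, div_le_iff₀ (by positivity)]
    have hπ3 := Real.pi_gt_three
    have hπ : (6 : ℝ) ≤ Real.pi ^ 2 := by nlinarith
    have h0 : 0 ≤ η ^ 2 * X ^ 2 := by positivity
    calc 6 * η ^ 2 * X ^ 2 = η ^ 2 * X ^ 2 * 6 := by ring
      _ ≤ η ^ 2 * X ^ 2 * Real.pi ^ 2 := mul_le_mul_of_nonneg_left hπ h0
  -- the Type I totals (class and parent)
  have hTIle := class_typeI_total_le (a := a) (b := b) (η := η) hC₂ hTI hXd hX hτ hτ1 hηlo hη1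
  have hTI0 : 0 ≤ ∑ D ∈ (idealsLE ⌊24 * X ^ (2 - τ) * hbL X τ⌋₊).filter (fun D => Squarefree (Ideal.absNorm D)),
      |(classCountA X η d a b D : ℝ) -
        (if Nat.Coprime d (Ideal.absNorm D) then classSizeA X η d * rho₂ D / Ideal.absNorm D else 0)| :=
    sum_nonneg fun _ _ => abs_nonneg _
  have hTIple := typeI_total_le (η := η) hC₂ hTIp hX hτ hτ1 hηlo hη1
  have hTIp0 : 0 ≤ ∑ D ∈ (idealsLE ⌊24 * X ^ (2 - τ) * hbL X τ⌋₊).filter (fun D => Squarefree (Ideal.absNorm D)),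
      |(countA X η D : ℝ) - sizeA X η * rho₂ D / Ideal.absNorm D| := sum_nonneg fun _ _ => abs_nonneg _
  -- `U_e(𝒜_cl)` written out, `U₁ = P`
  have hUe : bilin (classPairs X η d a b) pairIdeal cR (eWeight X τ m) =
      ∑ xy ∈ classPairs X η d a b, ∑ RS ∈ divisorPairs (pairIdeal xy), cR RS.1 *
        (wDeriv X τ m (Ideal.absNorm RS.2) / (∏ i, ((m i : ℝ) * hbXi τ * Real.log X)) *
          ∑ J ∈ (idealDivisors RS.2).filter (fun J => (Ideal.absNorm J : ℝ) < hbL X τ),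
            idealMoebius J * Real.log (hbL X τ / Ideal.absNorm J)) := by
    simp only [bilin, eWeight]
  have hP := (classU1_eq_pairs (d := d) (a := a) (b := b) (τ := τ) hX0 hη1 m cR (hbL X τ)).symm
  -- the common factor `(ξ log X)^n/∏ = 1/(M τ⁵ log X)`
  have hAeq : (hbXi τ * Real.log X) ^ n / ∏ i, ((m i : ℝ) * hbXi τ * Real.log X) =
      1 / ((∏ i, (m i : ℝ)) * (τ ^ 5 * Real.log X)) := by
    rw [hDeq, hΛeq]
    have : 0 < τ ^ 5 * Real.log X := by positivity
    field_simp
    ring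
  -- `E₂`, `Σ'`, `Σ₃`, `Σ₁^{(d)}`
  have hE2 := abs_classU1_sub_U2_le (η := η) (a := a) (b := b) hX1 hτ hτ1 hd hdτ hm hc
  rw [classSigmaOne_filter_lt_eq (d := d) hL1, hAeq, hlogL] at hE2
  have hSp := abs_sigmaPrime_le hX1 hτ hτ1 hm hc hharm
  rw [hAeq] at hSp
  have hSpsub := abs_sigmaPrime_sub_le hX hτ hτ1 hm hc hharm
  rw [hAeq] at hSpsub
  have hS3 := sum_alpha_div_eq_sigma3 hX1.le hτ m cR
  have hS1 := hSig1 (hbL X τ) hL1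
  rw [hlogL, show τ / 2 * Real.log X = τ * Real.log X / 2 by ring] at hS1
  -- the numerical error terms `E₂, E₃, E₄`
  have hQ0 : 0 ≤ ((∏ i, (m i : ℝ))⁻¹ * η ^ (5 / 2 : ℝ) * X ^ 2 * Real.log X ^ 2) := by positivity
  have hx1 : 0 ≤ 3 * C₃ * (gamma₀ + Cw) * ((∏ i, (m i : ℝ))⁻¹ * η ^ (5 / 2 : ℝ) * X ^ 2 * Real.log X ^ 2) := by
    positivity
  have hx2 : 0 ≤ 15 * C₃ ^ 2 * ((∏ i, (m i : ℝ))⁻¹ * η ^ (5 / 2 : ℝ) * X ^ 2 * Real.log X ^ 2) := by positivity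
  have hE2num := numeric_typeI_term hη0 hX0 hℓ1 hτ hM1 (hτpow 4 (by norm_num)) hTI0 hTIle hT2 hexp3 hη3
  have hE3 : classSizeA X η d * |∑ R ∈ idealsLE ⌊24 * X ^ 3⌋₊,
      (cR R * wDeriv X τ m (3 * X ^ 3 / Ideal.absNorm R) / ∏ i, ((m i : ℝ) * hbXi τ * Real.log X)) *
        (rho₂ R / Ideal.absNorm R)| *
      |(∑ J ∈ (idealsLE ⌊hbL X τ⌋₊).filter
          (fun J => Squarefree (Ideal.absNorm J) ∧ Nat.Coprime d (Ideal.absNorm J)),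
          idealMoebius J * Real.log (hbL X τ / Ideal.absNorm J) * (rho₂ J / Ideal.absNorm J)) -
        Real.pi ^ 2 / 6 * σ₀ * coprimeClassWeight d| ≤
      5 * C₁ * C₃ * ((∏ i, (m i : ℝ))⁻¹ * η ^ (5 / 2 : ℝ) * X ^ 2 * Real.log X ^ 2) := by
    refine le_trans (mul_le_mul_of_nonneg_left hS1 (mul_nonneg hsA0 (abs_nonneg _))) ?_
    exact numeric_E3 hη0 hX0 hℓ1 hτ hM1 hC₁ hC₃ (hτpow 5 (by norm_num)) hlN0 hlN4 hsA0 hsAle hSp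
      (Real.exp_pos _).le hexp hexp2 hη4
  have hE4 := numeric_E4 (σ := W * σ₀) hη0 hX1 hℓ1 hτ hM1 hC₂ hC₃ (hτpow 6 (by norm_num)) hlN0 hlN4 hSpsub
    hT2 hexp3 hη5
  -- `E₁`, by cases on the length of `𝐦`
  rcases n with _ | n
  · -- `𝐦 = (m₁)`
    have hδ := fun xy (hxy : xy ∈ classPairs X η d a b) (RS : Ideal (𝓞 K) × Ideal (𝓞 K))
        (hRS : RS ∈ divisorPairs (pairIdeal xy)) =>
      abs_wDeriv_cofactor_sub_le_one (η := η) (τ := τ) (m := m) hX1 (classPairs_subset_boxPairs X η d a b hxy)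
        ((mem_divisorPairs_iff (pairIdeal_ne_bot_of_mem_boxPairs hX0.le xy
          (classPairs_subset_boxPairs X η d a b hxy))).mp hRS)
    have hE1 := abs_classUe_sub_U1_le (d := d) (a := a) (b := b) hX0 hη1 hL1 m cR
      (fun R => if (3 * X ^ 3 / X ^ ((m 0 : ℝ) * hbXi τ) < (Ideal.absNorm R : ℝ) ∧
          (Ideal.absNorm R : ℝ) ≤ 3 * X ^ 3 * (1 + η) ^ 3 / X ^ ((m 0 : ℝ) * hbXi τ)) ∨
        (3 * X ^ 3 / X ^ (((m 0 : ℝ) + 1) * hbXi τ) < (Ideal.absNorm R : ℝ) ∧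
          (Ideal.absNorm R : ℝ) ≤ 3 * X ^ 3 * (1 + η) ^ 3 / X ^ (((m 0 : ℝ) + 1) * hbXi τ))
        then (1 : ℝ) else 0) hD0 hδ
    rw [← hUe] at hE1
    have hE1c := sum_pairs_classCountA_le_countA (X := X) (η := η) (d := d) (a := a) (b := b)
      (idealsLE ⌊24 * X ^ 3⌋₊) ((idealsLE ⌊hbL X τ⌋₊).filter (fun J => (Ideal.absNorm J : ℝ) < hbL X τ))
      (α := fun R => |cR R| * (if (3 * X ^ 3 / X ^ ((m 0 : ℝ) * hbXi τ) < (Ideal.absNorm R : ℝ) ∧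
          (Ideal.absNorm R : ℝ) ≤ 3 * X ^ 3 * (1 + η) ^ 3 / X ^ ((m 0 : ℝ) * hbXi τ)) ∨
        (3 * X ^ 3 / X ^ (((m 0 : ℝ) + 1) * hbXi τ) < (Ideal.absNorm R : ℝ) ∧
          (Ideal.absNorm R : ℝ) ≤ 3 * X ^ 3 * (1 + η) ^ 3 / X ^ (((m 0 : ℝ) + 1) * hbXi τ))
        then (1 : ℝ) else 0) / ∏ i, ((m i : ℝ) * hbXi τ * Real.log X))
      (β := fun J => |idealMoebius J| * Real.log (hbL X τ))
      (fun R => by positivity) (fun J => mul_nonneg (abs_nonneg _) (Real.log_nonneg hL1))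
    have hE1b := E1_pairs_le_one (η := η) hX1 hτ hτ1 hη0.le hη1 hm hc hCw hharm hwin
    have hE1num := numeric_E1_one hη0 hX0 hℓ1 hτ hM1 hC₃ hCw hγ (hτpow 3 (by norm_num))
      (hτpow 4 (by norm_num)) hlL0 hlL hsAple hηle hTIp0 hTIple hT2 hexp3 hη3
    have hE1tot : |bilin (classPairs X η d a b) pairIdeal cR (eWeight X τ m) -
        ∑ xy ∈ classPairs X η d a b, ∑ RS ∈ divisorPairs (pairIdeal xy), cR RS.1 *
          (wDeriv X τ m (3 * X ^ 3 / Ideal.absNorm RS.1) / (∏ i, ((m i : ℝ) * hbXi τ * Real.log X)) *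
            ∑ J ∈ (idealDivisors RS.2).filter (fun J => (Ideal.absNorm J : ℝ) < hbL X τ),
              idealMoebius J * Real.log (hbL X τ / Ideal.absNorm J))| ≤
        (3 * C₃ * (gamma₀ + Cw) + 1) * ((∏ i, (m i : ℝ))⁻¹ * η ^ (5 / 2 : ℝ) * X ^ 2 * Real.log X ^ 2) := by
      refine hE1.trans (hE1c.trans (hE1b.trans ?_))
      rw [hDeq, hΛeq, hlogL]
      exact hE1num
    refine class_assembly_abs_le hP hS3 hsAeq hsA0 hE1tot hE2 hE3 hE4 ?_
    linarith [hE2num, hx1, hx2, hQ0]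
  · -- `𝐦` of length `n + 2`
    have hδ := fun xy (hxy : xy ∈ classPairs X η d a b) (RS : Ideal (𝓞 K) × Ideal (𝓞 K))
        (hRS : RS ∈ divisorPairs (pairIdeal xy)) =>
      abs_wDeriv_cofactor_sub_le (η := η) (τ := τ) hX1 hτ hη0.le hη1 hm
        (classPairs_subset_boxPairs X η d a b hxy)
        ((mem_divisorPairs_iff (pairIdeal_ne_bot_of_mem_boxPairs hX0.le xy
          (classPairs_subset_boxPairs X η d a b hxy))).mp hRS)
    have hE1 := abs_classUe_sub_U1_le (d := d) (a := a) (b := b) hX0 hη1 hL1 m cR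
      (fun R => if (Ideal.absNorm R : ℝ) ≤ 24 * X ^ (2 - τ) then 6 * η * (hbXi τ * Real.log X) ^ n else 0)
      hD0 hδ
    rw [← hUe] at hE1
    have hE1c := sum_pairs_classCountA_le_countA (X := X) (η := η) (d := d) (a := a) (b := b)
      (idealsLE ⌊24 * X ^ 3⌋₊) ((idealsLE ⌊hbL X τ⌋₊).filter (fun J => (Ideal.absNorm J : ℝ) < hbL X τ))
      (α := fun R => |cR R| *
        (if (Ideal.absNorm R : ℝ) ≤ 24 * X ^ (2 - τ) then 6 * η * (hbXi τ * Real.log X) ^ n else 0) /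
          ∏ i, ((m i : ℝ) * hbXi τ * Real.log X))
      (β := fun J => |idealMoebius J| * Real.log (hbL X τ))
      (fun R => by positivity) (fun J => mul_nonneg (abs_nonneg _) (Real.log_nonneg hL1))
    have hE1b := E1_pairs_le_two (η := η) hX1 hτ hτ1 hη0.le hm hc hC₃ hharm
    have hE1num := numeric_E1_two (n := n) hη0 hX0 hℓ1 hτ hM1 hC₃ (hτpow 8 (by norm_num))
      (hτpow 9 (by norm_num)) hlN0 hlN4 hlL0 hlL hsAple hTIp0 hTIple hT1 hexp3 hη3 hη4
    have hE1tot : |bilin (classPairs X η d a b) pairIdeal cR (eWeight X τ m) -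
        ∑ xy ∈ classPairs X η d a b, ∑ RS ∈ divisorPairs (pairIdeal xy), cR RS.1 *
          (wDeriv X τ m (3 * X ^ 3 / Ideal.absNorm RS.1) / (∏ i, ((m i : ℝ) * hbXi τ * Real.log X)) *
            ∑ J ∈ (idealDivisors RS.2).filter (fun J => (Ideal.absNorm J : ℝ) < hbL X τ),
              idealMoebius J * Real.log (hbL X τ / Ideal.absNorm J))| ≤
        (15 * C₃ ^ 2 + 1) * ((∏ i, (m i : ℝ))⁻¹ * η ^ (5 / 2 : ℝ) * X ^ 2 * Real.log X ^ 2) := by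
      refine hE1.trans (hE1c.trans (hE1b.trans ?_))
      rw [hDeq, hΛeq, hlogL]
      exact hE1num
    refine class_assembly_abs_le hP hS3 hsAeq hsA0 hE1tot hE2 hE3 hE4 ?_
    linarith [hE2num, hx1, hx2, hQ0]

end Assembly

end Summit.Parity.GeneralizedHardyLittlewood.Theorems.GoldbachHeathBrownDispersionHeathBrownMorozUniform

end
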